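import Summits.ResolutionOfSingularities.ResolutionOfSingularities.Theorems.FrobeniusClosingPatchingRelPerfectDepthMultiHostCyl
import Literature.AlgebraicGeometry.Resolution.StrictNormalCrossingsLabels
import Literature.AlgebraicGeometry.Resolution.StalkIdealLemmas
import Literature.AlgebraicGeometry.Resolution.MarkedIdealsArithmetic
import Literature.AlgebraicGeometry.Resolution.AlterationsSectionDivisor
import Literature.AlgebraicGeometry.Resolution.BoundarySplitting
import Literature.AlgebraicGeometry.Resolution.AlterationsEnlargingZ
import HarnessLib

/-!
# Crux `PatchingRelPerfect` (stmt-ResolutionOfSingularities-16161), chain W5.2 — F7(β) d = 2 (β-AX), X2a module 2 (M2a), part 1: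
# CYL-SNC — simple normal crossings lift from the carrier to the cylinder region of a cylinder state

[OURS · L1 W5.2 · F7(β) (β-AX) X-side · res-D-pv-034 AS res-L1-s36-pv-3 per res-L1-w52-plan-1 RULING G11-21 (2026-08-27T16:43:39Z,
module 2 split (M2a)/(M2b)/(M2c)) and NOTE G11-22 («ONE snc-lifting lemma serves M2a AND T2c — general form first»).]  Replaces the
role of NO printed item; NOT a statement of the manuscript under review; fact-free, def-free.  AI-written; AI review is weaker than
expert review.  Setting: `cyl : CylState S` (p544351) — carrier `j : Z ⟶ X` (closed immersion, `j.ker ∈ S.𝓔`), cylinder region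
`V ⊇ j(Z)` with retraction `q : V ⟶ Z` (`jV ≫ q = 𝟙`), cylinder identities, PARAM-LIFT `cyl.param`.  Part 2 (`…CylCentre`): the
pushed centre and T2a (a) `CylState.hasSNCWith_centre`.

## Contents
* §0 local algebra: `isRsopPart_comp_ringEquiv`, `IsRsopPart.isPrime_span_image`; the SECTION LEMMA
  `maximalIdeal_eq_span_sup_map_of_section` (`σ : A → B`, `π : B → A′` local, `π ∘ σ` bijective, `ker π = (t)` ⇒
  `𝔪_B = (t) ⊔ 𝔪_A B`) and `ringKrullDim_eq_of_section` (`dim B = dim A′ + 1`).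
* §1–§2 the cylinder state at a point: `stalkIdeal_map_stalkCongr_hom`, `CylState.V_ι_jV`, `q_jV`, `isRegularLocalRing_stalk_V`,
  `mem_support_carrier_iff`, **`exists_carrier_equation`** (at `jV z₀`: a local equation `t ≠ 0` of the carrier generating
  `(𝓘_Z|_V)_{jV z₀}` and `ker (jV^#)`), and THE ENGINE **`exists_isRsopPart_labels_cylinder`**: at every `y ∈ V` a part `z` of a
  regular system of parameters of `𝒪_{V,y}` labelling the carrier and the cylinders `q^* F` (`F ∈ 𝓕` through `q y`) injectively,
  with `q^* C` and `𝓘_Z|_V ⊔ q^* C` generated by sub-tuples — at carrier points `z = (t, q^* v)` by the section argument, elsewhere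
  `z = (q^* v, s)` with the extra parameters `s` of `cyl.param y` (no carrier-membership of the point is needed).
* **CYL-SNC** (G11-22, serves T2c `CylState.isFormatSncOn_of_cjsEnd` and T2a (a)): `CylState.hasSNCWith_cylinder`
  (`HasSNCWith 𝓕 C → HasSNCWith (𝓘_Z|_V :: 𝓕.map q^*) (q^* C)`), `CylState.hasSNC_cylinder`,
  `CylState.hasSNCWith_carrier_sup_cylinder` (centre `𝓘_Z|_V ⊔ q^* C` = the pushed centre `j V(C)` read on `V`, part 2).
## References
* J. Kollár, *Lectures on Resolution of Singularities* (2007), (3.111) Step 1 (product/retraction set-up). [Kollar2007]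
* E. Bierstone, D. Grigoriev, P. Milman, J. Włodarczyk, arXiv:1206.3090, Def. 3.1.1, Def. 3.1.3 (2). [BierstoneGrigorievMilmanWlodarczyk2011]
* H. Matsumura, *Commutative Ring Theory* (1986), Thm. 14.2, Thm. 14.3. [Matsumura1987] -/
-- `Summit.<Summit>.<Sub>.Theorems` with `Sub = Summit` (single-conjunct summit, D-0017)
set_option linter.dupNamespace false

noncomputable section

open CategoryTheory AlgebraicGeometry TopologicalSpace IsLocalRing
open Literature.AlgebraicGeometry.Resolution
open Scheme.IdealSheafData

namespace Summit.ResolutionOfSingularities.ResolutionOfSingularities.Theorems.DepthMultiHost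

universe u

/-! ## §0 Local algebra -/

section Algebra

/-- Parts of regular systems of parameters transport along ring isomorphisms (a copy of the tree's `IsRsopPart.map_ringEquiv` of
`NormalCrossingsBlowupStepReduction.lean`, not imported here for its weight). [folklore] -/
theorem isRsopPart_comp_ringEquiv {R R' : Type u} [CommRing R]
    [CommRing R'] [IsLocalRing R] [IsLocalRing R'] (e : R ≃+* R') {n : ℕ} {z : Fin n → R} (hz : IsRsopPart z) :
    IsRsopPart (e ∘ z) := by
  obtain ⟨hR, k, y, hdim, hspan⟩ := hz
  haveI := hR
  refine ⟨IsRegularLocalRing.of_ringEquiv e, k, e ∘ y, ?_, ?_⟩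
  · rw [← ringKrullDim_eq_of_ringEquiv e, hdim]
  · rw [Set.range_comp, Set.range_comp, ← Set.image_union, ← Ideal.map_span e, hspan]
    exact map_ringEquiv_maximalIdeal e

/-- **The section lemma.** `σ : A → B`, `π : B → A'` local homomorphisms of local rings with `π ∘ σ` bijective and
`ker π = (t)`: then `𝔪_B = (t) ⊔ 𝔪_A B`. [folklore] -/
theorem maximalIdeal_eq_span_sup_map_of_section {A A' B : Type u} [CommRing A] [CommRing A'] [CommRing B]
    [IsLocalRing A] [IsLocalRing A'] [IsLocalRing B] (σ : A →+* B) (π : B →+* A') [IsLocalHom σ] [IsLocalHom π]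
    (hbij : Function.Bijective (π.comp σ)) {t : B} (hker : RingHom.ker π = Ideal.span {t}) (ht : t ∈ maximalIdeal B) :
    maximalIdeal B = Ideal.span {t} ⊔ (maximalIdeal A).map σ := by
  apply le_antisymm
  · intro b hb
    obtain ⟨a, ha⟩ := hbij.2 (π b)
    have hmem : b - σ a ∈ RingHom.ker π := by
      rw [RingHom.mem_ker, map_sub, ← RingHom.comp_apply, ha, sub_self]
    rw [hker] at hmem
    have ha' : a ∈ maximalIdeal A := by
      have h1 : π b ∈ maximalIdeal A' := map_nonunit π b hb
      rw [← ha] at h1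
      exact (map_mem_nonunits_iff (π.comp σ) a).mp h1
    have : b = (b - σ a) + σ a := by ring
    rw [this]
    exact Ideal.add_mem _ (Ideal.mem_sup_left hmem) (Ideal.mem_sup_right (Ideal.mem_map_of_mem σ ha'))
  · refine sup_le ?_ ?_
    · rw [Ideal.span_singleton_le_iff_mem]; exact ht
    · exact map_maximalIdeal_le σ

/-- **The dimension lemma.** `B` regular local, `π : B → A'` surjective with `ker π = (t)`, `t ≠ 0` in `𝔪_B`: then
`dim B = dim A' + 1`. [cite: Matsumura1987, Thm. 14.2] -/
theorem ringKrullDim_eq_of_section {A' B : Type u} [CommRing A'] [CommRing B] [IsRegularLocalRing B]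
    (π : B →+* A') (hπ : Function.Surjective π) {t : B} (hker : RingHom.ker π = Ideal.span {t})
    (ht : t ∈ maximalIdeal B) (ht0 : t ≠ 0) : ringKrullDim B = ringKrullDim A' + 1 := by
  have e : B ⧸ Ideal.span {t} ≃+* A' :=
    (Ideal.quotEquivOfEq hker.symm).trans (RingHom.quotientKerEquivOfSurjective hπ)
  rw [← ringKrullDim_eq_of_ringEquiv e]
  haveI : IsDomain B := isDomain_of_isRegularLocalRing B
  exact (ringKrullDim_quotient_span_singleton_succ_eq_ringKrullDim_of_mem_nonZeroDivisors
    (mem_nonZeroDivisors_of_ne_zero ht0) ht).symm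

/-- The ideal generated by the image of a set under a part of a regular system of parameters is prime. [cite: Matsumura1987, Thm. 14.3] -/
theorem _root_.Literature.AlgebraicGeometry.Resolution.IsRsopPart.isPrime_span_image {R : Type u} [CommRing R] [IsLocalRing R]
    {n : ℕ} {z : Fin n → R} (hz : IsRsopPart z) (T : Set (Fin n)) : (Ideal.span (z '' T)).IsPrime := by
  classical
  haveI := hz.isRegularLocalRing
  obtain ⟨e, x, hd, hx, hxz⟩ := hz.exists_rsop
  have hT : z '' T = x '' ((T.toFinite.toFinset.image (Fin.castAdd e) : Finset (Fin (n + e))) : Set (Fin (n + e))) := by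
    rw [Finset.coe_image, Set.Finite.coe_toFinset, Set.image_image]
    exact Set.image_congr fun i _ => (hxz i).symm
  rw [hT]
  exact _root_.Literature.AlgebraicGeometry.Resolution.isPrime_span_image hd x hx _


end Algebra

/-! ## §1 Stalk transport along an equality of points -/

section Points

variable {X : Scheme.{u}}
/-- `K_x · 𝒪 = K_y` along the canonical identification of stalks at equal points. [folklore] -/
theorem stalkIdeal_map_stalkCongr_hom {x y : X} (h : x = y) (K : X.IdealSheafData) :
    (stalkIdeal K x).map (X.presheaf.stalkCongr (.of_eq h)).hom.hom = stalkIdeal K y := by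
  subst h
  simp only [TopCat.Presheaf.stalkCongr_hom, TopCat.Presheaf.stalkSpecializes_refl, CommRingCat.hom_id,
    Ideal.map_id]

end Points

/-! ## §2 The cylinder state at a point of the cylinder region -/

namespace CylState

variable {X : Scheme.{u}} {S : MultiHostState X} (cyl : CylState S)

/-- `V.ι (jV z) = j z`. [folklore] -/
theorem V_ι_jV (z : cyl.Z) : cyl.V.ι (cyl.jV z) = cyl.j z := by
  rw [← Scheme.Hom.comp_apply, cyl.jV_ι]

/-- `q (jV z) = z`. [folklore] -/
theorem q_jV (z : cyl.Z) : cyl.q (cyl.jV z) = z := by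
  rw [← Scheme.Hom.comp_apply, cyl.retract]; rfl

/-- The stalks of `X` are regular (the member family has simple normal crossings). [folklore] -/
theorem _root_.Summit.ResolutionOfSingularities.ResolutionOfSingularities.Theorems.DepthMultiHost.MultiHostState.isRegularLocalRing_stalk
    (S : MultiHostState X) (x : X) : IsRegularLocalRing (X.presheaf.stalk x) := (S.snc x).1

/-- The stalks of the cylinder region are regular. [folklore] -/
theorem isRegularLocalRing_stalk_V (y : (cyl.V : Scheme.{u})) :
    IsRegularLocalRing ((cyl.V : Scheme.{u}).presheaf.stalk y) :=
  haveI := S.isRegularLocalRing_stalk (cyl.V.ι y)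
  IsRegularLocalRing.of_ringEquiv (asIso (cyl.V.ι.stalkMap y)).commRingCatIsoToRingEquiv

/-- The support of the carrier read on `V` is the image of `jV`. [folklore] -/
theorem mem_support_carrier_iff (y : (cyl.V : Scheme.{u})) :
    y ∈ (cyl.j.ker.comap cyl.V.ι).support ↔ ∃ z, cyl.jV z = y := by
  haveI := cyl.closedImmersion
  rw [support_comap]
  change cyl.V.ι y ∈ (cyl.j.ker.support : Set X) ↔ _
  rw [Scheme.Hom.support_ker, cyl.j.isClosedEmbedding.isClosed_range.closure_eq]
  constructor
  · rintro ⟨z, hz⟩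
    exact ⟨z, cyl.V.ι.isOpenEmbedding.injective (by rw [V_ι_jV, hz])⟩
  · rintro ⟨z, rfl⟩
    exact ⟨z, (cyl.V_ι_jV z).symm⟩

/-- **The carrier at a carrier point**: a local equation `t ≠ 0` of the carrier at `jV z₀` generating both the stalk of
`𝓘_Z|_V` and the kernel of the stalk map of `jV`. [folklore] -/
theorem exists_carrier_equation (z₀ : cyl.Z) :
    ∃ t : (cyl.V : Scheme.{u}).presheaf.stalk (cyl.jV z₀), t ≠ 0 ∧
      t ∈ maximalIdeal ((cyl.V : Scheme.{u}).presheaf.stalk (cyl.jV z₀)) ∧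
      stalkIdeal (cyl.j.ker.comap cyl.V.ι) (cyl.jV z₀) = Ideal.span {t} ∧
      RingHom.ker (cyl.jV.stalkMap z₀).hom = Ideal.span {t} := by
  haveI := cyl.closedImmersion
  -- the member data at the point `V.ι (jV z₀) = j z₀`
  have hx : cyl.j z₀ = cyl.V.ι (cyl.jV z₀) := (cyl.V_ι_jV z₀).symm
  have hker₀ : stalkIdeal cyl.j.ker (cyl.j z₀) = RingHom.ker (cyl.j.stalkMap z₀).hom :=
    stalkIdeal_ker_eq_ker_stalkMap cyl.j z₀
  have hx₁ : cyl.V.ι (cyl.jV z₀) ∈ cyl.j.ker.support := by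
    rw [← hx, mem_support_iff_stalkIdeal_le, hker₀]
    exact le_maximalIdeal (RingHom.ker_ne_top _)
  obtain ⟨m, u, hu, ⟨ι, -, hιD⟩, -⟩ := S.snc.exists_isRsopPart_labels (cyl.V.ι (cyl.jV z₀))
  set a := ι ⟨cyl.j.ker, cyl.ker_mem, hx₁⟩ with ha
  have hja : stalkIdeal cyl.j.ker (cyl.V.ι (cyl.jV z₀)) = Ideal.span {u a} := hιD ⟨cyl.j.ker, cyl.ker_mem, hx₁⟩
  set ε : X.presheaf.stalk (cyl.V.ι (cyl.jV z₀)) →+* (cyl.V : Scheme.{u}).presheaf.stalk (cyl.jV z₀) :=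
    (cyl.V.ι.stalkMap (cyl.jV z₀)).hom with hε
  have hεbij : Function.Bijective ε := (asIso (cyl.V.ι.stalkMap (cyl.jV z₀))).commRingCatIsoToRingEquiv.bijective
  refine ⟨ε (u a), ?_, ?_, ?_, ?_⟩
  · exact fun h0 => hu.ne_zero a (hεbij.1 (by rw [h0, map_zero]))
  · have hna : u a ∈ maximalIdeal _ := hu.mem_maximalIdeal a
    rw [IsLocalRing.mem_maximalIdeal, mem_nonunits_iff] at hna ⊢
    exact fun hunit => hna (isUnit_of_map_unit ε _ hunit)
  · rw [stalkIdeal_comap_eq_map_stalkMap, hja, Ideal.map_span, Set.image_singleton]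
  · -- `j^# = jV^# ∘ ε ∘ c`
    let c : X.presheaf.stalk (cyl.j z₀) ≅ X.presheaf.stalk (cyl.V.ι (cyl.jV z₀)) := X.presheaf.stalkCongr (.of_eq hx)
    have hcomp : cyl.j.stalkMap z₀ = c.hom ≫ cyl.V.ι.stalkMap (cyl.jV z₀) ≫ cyl.jV.stalkMap z₀ := by
      rw [← Scheme.Hom.stalkMap_comp]
      exact Scheme.Hom.stalkMap_congr_hom cyl.j (cyl.jV ≫ cyl.V.ι) cyl.jV_ι.symm z₀
    have hhom : (cyl.j.stalkMap z₀).hom =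
        (cyl.jV.stalkMap z₀).hom.comp (ε.comp c.hom.hom) := by
      rw [hcomp]; rfl
    have hφ : Function.Surjective (ε.comp c.hom.hom) :=
      hεbij.2.comp c.commRingCatIsoToRingEquiv.surjective
    calc RingHom.ker (cyl.jV.stalkMap z₀).hom
        = ((RingHom.ker (cyl.jV.stalkMap z₀).hom).comap (ε.comp c.hom.hom)).map (ε.comp c.hom.hom) :=
          (Ideal.map_comap_of_surjective _ hφ _).symm
      _ = (RingHom.ker (cyl.j.stalkMap z₀).hom).map (ε.comp c.hom.hom) := by
          rw [RingHom.comap_ker, ← hhom]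
      _ = ((stalkIdeal cyl.j.ker (cyl.j z₀)).map c.hom.hom).map ε := by
          rw [← hker₀, Ideal.map_map]
      _ = Ideal.span {ε (u a)} := by
          rw [stalkIdeal_map_stalkCongr_hom hx, hja, Ideal.map_span, Set.image_singleton]

/-- **CYL-SNC at a point (the engine).** For an snc family `𝓕` on the carrier with snc centre `C` and a point `y` of the
cylinder region: a part `z` of a regular system of parameters of `𝒪_{V,y}` labelling the carrier `𝓘_Z|_V` (if `y` lies on it)
and the cylinders `q^* F` (`F ∈ 𝓕` through `q y`) injectively, with the cylinder `q^* C` and the pushed centre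
`𝓘_Z|_V ⊔ q^* C` generated by sub-tuples.  At a carrier point `z = (t, q^* v)` for a local equation `t` of the carrier
and an adapted system `v` on the carrier (section argument); elsewhere `z = (q^* v, s)` with the extra parameters `s` of
`cyl.param y`. [cite: Kollar2007, (3.111) Step 1] [cite: BierstoneGrigorievMilmanWlodarczyk2011, Def. 3.1.1 and Def. 3.1.3 (2)] -/
theorem exists_isRsopPart_labels_cylinder (𝓕 : List cyl.Z.IdealSheafData) (C : cyl.Z.IdealSheafData)
    (h : HasSNCWith 𝓕 C) (y : (cyl.V : Scheme.{u})) :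
    ∃ (m : ℕ) (z : Fin m → (cyl.V : Scheme.{u}).presheaf.stalk y), IsRsopPart z ∧
      (∃ ι : {D : (cyl.V : Scheme.{u}).IdealSheafData //
          D ∈ (cyl.j.ker.comap cyl.V.ι :: 𝓕.map fun F => F.comap cyl.q) ∧ y ∈ D.support} → Fin m,
        Function.Injective ι ∧ ∀ D, stalkIdeal D.1 y = Ideal.span {z (ι D)}) ∧
      (y ∈ (C.comap cyl.q).support → ∃ T : Set (Fin m), stalkIdeal (C.comap cyl.q) y = Ideal.span (z '' T)) ∧
      (y ∈ (cyl.j.ker.comap cyl.V.ι ⊔ C.comap cyl.q).support →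
        ∃ T : Set (Fin m), stalkIdeal (cyl.j.ker.comap cyl.V.ι ⊔ C.comap cyl.q) y = Ideal.span (z '' T)) := by
  classical
  haveI hB : IsRegularLocalRing ((cyl.V : Scheme.{u}).presheaf.stalk y) := cyl.isRegularLocalRing_stalk_V y
  set σ : cyl.Z.presheaf.stalk (cyl.q y) →+* (cyl.V : Scheme.{u}).presheaf.stalk y := (cyl.q.stalkMap y).hom with hσ
  -- the carrier data at `q y`
  obtain ⟨m₀, v, hv, ⟨ι₀, hι₀, hι₀D⟩, hC₀⟩ := h.exists_isRsopPart_labels (cyl.q y)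
  obtain ⟨hA, e, w, hdimA, hspanA⟩ := id hv
  haveI := hA
  have hsfrA : (maximalIdeal (cyl.Z.presheaf.stalk (cyl.q y))).spanFinrank = m₀ + e := by
    have h1 := IsRegularLocalRing.spanFinrank_maximalIdeal (R := cyl.Z.presheaf.stalk (cyl.q y))
    rw [hdimA] at h1
    exact_mod_cast h1
  have hcyl : ∀ F : cyl.Z.IdealSheafData, stalkIdeal (F.comap cyl.q) y = (stalkIdeal F (cyl.q y)).map σ :=
    fun F => stalkIdeal_comap_eq_map_stalkMap cyl.q F y
  -- KEY: a part of a regular system of parameters containing `q^* v` (and the carrier equation at carrier points)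
  have key : ∃ (m : ℕ) (z : Fin m → (cyl.V : Scheme.{u}).presheaf.stalk y) (emb : Fin m₀ → Fin m),
      IsRsopPart z ∧ Function.Injective emb ∧ (∀ i, z (emb i) = σ (v i)) ∧
      (y ∈ (cyl.j.ker.comap cyl.V.ι).support →
        ∃ i₀, i₀ ∉ Set.range emb ∧ stalkIdeal (cyl.j.ker.comap cyl.V.ι) y = Ideal.span {z i₀}) := by
    by_cases hy : y ∈ (cyl.j.ker.comap cyl.V.ι).support
    · -- a carrier point: `z = (t, q^* v)`
      obtain ⟨z₀, rfl⟩ := (cyl.mem_support_carrier_iff y).mp hy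
      obtain ⟨t, ht0, htm, hst, hker⟩ := cyl.exists_carrier_equation z₀
      set π' : (cyl.V : Scheme.{u}).presheaf.stalk (cyl.jV z₀) →+* cyl.Z.presheaf.stalk z₀ :=
        (cyl.jV.stalkMap z₀).hom with hπ'
      have hiso : IsIso ((cyl.jV ≫ cyl.q).stalkMap z₀) := by
        rw [cyl.retract, Scheme.Hom.stalkMap_id]; exact IsIso.id _
      have hcomp : ((cyl.jV ≫ cyl.q).stalkMap z₀).hom = π'.comp σ := by
        rw [Scheme.Hom.stalkMap_comp]; rfl
      have hbij : Function.Bijective (π'.comp σ) := by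
        rw [← hcomp]; exact (asIso ((cyl.jV ≫ cyl.q).stalkMap z₀)).commRingCatIsoToRingEquiv.bijective
      have hmax := maximalIdeal_eq_span_sup_map_of_section σ π' hbij hker htm
      have hsurj : Function.Surjective π' := Function.Surjective.of_comp (g := σ) hbij.2
      have hdimB := ringKrullDim_eq_of_section π' hsurj hker htm ht0
      have hdimZ : ringKrullDim (cyl.Z.presheaf.stalk z₀) = ringKrullDim (cyl.Z.presheaf.stalk (cyl.q (cyl.jV z₀))) :=
        (ringKrullDim_eq_of_ringEquiv (RingEquiv.ofBijective (π'.comp σ) hbij)).symm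
      refine ⟨m₀ + 1, Fin.cons t (σ ∘ v), Fin.succ, ⟨hB, e, σ ∘ w, ?_, ?_⟩, Fin.succ_injective _,
        fun i => by simp, fun _ => ⟨0, ?_, by simpa using hst⟩⟩
      · rw [hdimB, hdimZ, hdimA, show m₀ + 1 + e = (m₀ + e) + 1 by omega, Nat.cast_succ]
      · rw [Fin.range_cons, Set.insert_union, Ideal.span_insert, Set.range_comp, Set.range_comp, ← Set.image_union,
          ← Ideal.map_span, hspanA, hmax]
      · rintro ⟨i, hi⟩
        exact Fin.succ_ne_zero i hi
    · -- off the carrier: `z = (q^* v, s)` from PARAM-LIFT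
      obtain ⟨s, hs1, hs2⟩ := cyl.param y
      set k := s.card with hk
      let sv : Fin k → (cyl.V : Scheme.{u}).presheaf.stalk y := fun i => ((s.equivFin.symm i : s) : _)
      have hsv : Set.range sv = (s : Set _) := by
        ext b
        constructor
        · rintro ⟨i, rfl⟩; exact (s.equivFin.symm i).2
        · intro hb; exact ⟨s.equivFin ⟨b, hb⟩, by simp [sv]⟩
      have hsfrB : (maximalIdeal ((cyl.V : Scheme.{u}).presheaf.stalk y)).spanFinrank = k + (m₀ + e) := by
        rw [← hs2, hsfrA]
      refine ⟨m₀ + k, Fin.append (σ ∘ v) sv, Fin.castAdd k, ⟨hB, e, σ ∘ w, ?_, ?_⟩, Fin.castAdd_injective _ _,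
        fun i => by simp, fun hy' => absurd hy' hy⟩
      · rw [← IsRegularLocalRing.spanFinrank_maximalIdeal, hsfrB, show k + (m₀ + e) = m₀ + k + e by omega]
      · rw [range_fin_append, hsv, Set.range_comp, Set.range_comp, Set.union_right_comm, ← Set.image_union,
          Ideal.span_union, ← Ideal.map_span, hspanA, hs1]
  obtain ⟨m, z, emb, hz, hemb, hzemb, hcar⟩ := key
  -- the cylinders through `y`
  have hpick : ∀ D : {D : (cyl.V : Scheme.{u}).IdealSheafData //
      D ∈ (cyl.j.ker.comap cyl.V.ι :: 𝓕.map fun F => F.comap cyl.q) ∧ y ∈ D.support},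
      D.1 ≠ cyl.j.ker.comap cyl.V.ι → ∃ F : {F : cyl.Z.IdealSheafData // F ∈ 𝓕 ∧ cyl.q y ∈ F.support},
        F.1.comap cyl.q = D.1 := by
    rintro ⟨D, hD, hyD⟩ hne
    rcases List.mem_cons.mp hD with h1 | h1
    · exact absurd h1 hne
    · obtain ⟨F, hF, rfl⟩ := List.mem_map.mp h1
      refine ⟨⟨F, hF, ?_⟩, rfl⟩
      rw [support_comap] at hyD
      exact hyD
  -- the labelling
  let lab : {D : (cyl.V : Scheme.{u}).IdealSheafData //
      D ∈ (cyl.j.ker.comap cyl.V.ι :: 𝓕.map fun F => F.comap cyl.q) ∧ y ∈ D.support} → Fin m := fun D =>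
    if hD : D.1 = cyl.j.ker.comap cyl.V.ι then (hcar (hD ▸ D.2.2)).choose else emb (ι₀ (hpick D hD).choose)
  refine ⟨m, z, hz, ⟨lab, ?_, ?_⟩, ?_, ?_⟩
  · -- injective
    intro D₁ D₂ h12
    by_cases h₁ : D₁.1 = cyl.j.ker.comap cyl.V.ι <;> by_cases h₂ : D₂.1 = cyl.j.ker.comap cyl.V.ι
    · exact Subtype.ext (h₁.trans h₂.symm)
    · exfalso
      simp only [lab, dif_pos h₁, dif_neg h₂] at h12
      exact (hcar (h₁ ▸ D₁.2.2)).choose_spec.1 ⟨_, h12.symm⟩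
    · exfalso
      simp only [lab, dif_neg h₁, dif_pos h₂] at h12
      exact (hcar (h₂ ▸ D₂.2.2)).choose_spec.1 ⟨_, h12⟩
    · simp only [lab, dif_neg h₁, dif_neg h₂] at h12
      have hF := hι₀ (hemb h12)
      apply Subtype.ext
      rw [← (hpick D₁ h₁).choose_spec, ← (hpick D₂ h₂).choose_spec, hF]
  · -- stalks
    rintro ⟨D, hDmem, hyD⟩
    by_cases hD : D = cyl.j.ker.comap cyl.V.ι
    · subst hD
      simp only [lab, dif_pos rfl]
      exact (hcar hyD).choose_spec.2
    · simp only [lab, dif_neg hD]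
      have hF : (hpick ⟨D, hDmem, hyD⟩ hD).choose.1.comap cyl.q = D := (hpick ⟨D, hDmem, hyD⟩ hD).choose_spec
      conv_lhs => rw [← hF]
      rw [hcyl, hι₀D, Ideal.map_span, Set.image_singleton, hzemb]
  · -- the cylinder over the centre
    intro hyC
    rw [support_comap] at hyC
    obtain ⟨T₀, hT₀⟩ := hC₀ hyC
    refine ⟨emb '' T₀, ?_⟩
    rw [hcyl, hT₀, Ideal.map_span, Set.image_image, Set.image_image]
    congr 1
    exact Set.image_congr fun i _ => (hzemb i).symm
  · -- the pushed centre `𝓘_Z|_V ⊔ q^* C`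
    intro hyW
    rw [Scheme.IdealSheafData.support_sup] at hyW
    obtain ⟨i₀, -, hi₀⟩ := hcar hyW.1
    have hyC : cyl.q y ∈ C.support := by
      have := hyW.2; rw [support_comap] at this; exact this
    obtain ⟨T₀, hT₀⟩ := hC₀ hyC
    refine ⟨insert i₀ (emb '' T₀), ?_⟩
    rw [stalkIdeal_sup, hi₀, hcyl, hT₀, Ideal.map_span, Set.image_insert_eq, Ideal.span_insert, Set.image_image,
      Set.image_image]
    congr 2
    exact Set.image_congr fun i _ => (hzemb i).symm


/-! ### The three global forms of CYL-SNC -/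

/-- [OURS · L1 W5.2 · F7(β) (β-AX)] **CYL-SNC, centre a cylinder** (res-L1-w52-plan-1 NOTE G11-22): an snc family `𝓕` on the
carrier having simple normal crossings with `C` pulls back under the retraction `q` to the family «carrier `𝓘_Z|_V`, cylinders
`q^* F`» on the cylinder region, which has simple normal crossings with the cylinder `q^* C`.  Serves T2c
(`CylState.isFormatSncOn_of_cjsEnd`) and T2a (a). [cite: Kollar2007, (3.111) Step 1]
[cite: BierstoneGrigorievMilmanWlodarczyk2011, Def. 3.1.1 and Def. 3.1.3 (2)] -/
theorem hasSNCWith_cylinder (𝓕 : List cyl.Z.IdealSheafData) (C : cyl.Z.IdealSheafData) (h : HasSNCWith 𝓕 C) :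
    HasSNCWith (cyl.j.ker.comap cyl.V.ι :: 𝓕.map fun F => F.comap cyl.q) (C.comap cyl.q) :=
  hasSNCWith_of_isRsopPart_labels _ _ fun y => by
    obtain ⟨m, z, hz, hlab, hC, -⟩ := cyl.exists_isRsopPart_labels_cylinder 𝓕 C h y
    exact ⟨m, z, hz, hlab, hC⟩

/-- [OURS · L1 W5.2 · F7(β) (β-AX)] **CYL-SNC, no centre**: the carrier and the cylinders over an snc family on the carrier form an
snc family on the cylinder region. [cite: Kollar2007, (3.111) Step 1] [cite: BierstoneGrigorievMilmanWlodarczyk2011, Def. 3.1.1] -/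
theorem hasSNC_cylinder (𝓕 : List cyl.Z.IdealSheafData) (h : HasSNC 𝓕) :
    HasSNC (cyl.j.ker.comap cyl.V.ι :: 𝓕.map fun F => F.comap cyl.q) := by
  have h' := cyl.hasSNCWith_cylinder 𝓕 ⊤ h
  rwa [Scheme.IdealSheafData.comap_top] at h'

/-- [OURS · L1 W5.2 · F7(β) (β-AX)] **CYL-SNC, centre = carrier ⊔ cylinder** (the pushed centre `j V(C)` read on the cylinder
region, `comap_V_ι_vanishingIdeal_centre`). [cite: Kollar2007, (3.111) Step 1] [cite: BierstoneGrigorievMilmanWlodarczyk2011, Def. 3.1.3 (2)] -/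
theorem hasSNCWith_carrier_sup_cylinder (𝓕 : List cyl.Z.IdealSheafData) (C : cyl.Z.IdealSheafData)
    (h : HasSNCWith 𝓕 C) :
    HasSNCWith (cyl.j.ker.comap cyl.V.ι :: 𝓕.map fun F => F.comap cyl.q)
      (cyl.j.ker.comap cyl.V.ι ⊔ C.comap cyl.q) :=
  hasSNCWith_of_isRsopPart_labels _ _ fun y => by
    obtain ⟨m, z, hz, hlab, -, hW⟩ := cyl.exists_isRsopPart_labels_cylinder 𝓕 C h y
    exact ⟨m, z, hz, hlab, hW⟩

end CylState

end Summit.ResolutionOfSingularities.ResolutionOfSingularities.Theorems.DepthMultiHost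

end
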